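import Literature.NumberTheory.Rogawski1990.ExplicitFactorProductFormulaGHRegularParts
import HarnessLib

/-!
# THE PRODUCT FORMULA FOR ROGAWSKI'S EXPLICIT TRANSFER FACTORS AT `(G,H)`-REGULAR (POSSIBLY `G`-SINGULAR) RATIONAL PAIRS:
# `(∏_v Δ‴_v(γ_H, γ)) · Δ‴_∞(γ_H ⊗ 1, γ ⊗ 1) = 1` as soon as `χ_g(u) ≠ 0` — PART 2: the three partial products and the assembly

Topic `NumberTheory/Rogawski1990`; namespace `Literature.NumberTheory.Rogawski1990`.  THEOREMS ONLY (no definition, no named fact, no instance, no notation,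
no `sorry`); imports part 1 `ExplicitFactorProductFormulaGHRegularParts` (the `κ`-side inputs under `χ_g(u) ≠ 0`) and through it ★ `ExplicitFactorProductFormula`
(p828307).  Cell `pub/hodgecm-mathlib`, F0∕P3a, seat F0P3a-p05 (g9); part 2 of the (P-α) brick of the #88 repair census `F0/P3a/F0P3a-p05/g9/SIZING-S1prime.F0P3a-p05g9.md` §2 row (κ-sign) (LEAD DESK WORDS T6-33 (b), T6-35).

WHAT.  ★ `satisfiesProductFormula_finExplicitCollection` (p828307) proves the product formula `(∏ᶠ_v Δ‴_v(γ_H, γ)) · Δ‴_∞(γ_H ⊗ 1, γ ⊗ 1) = 1` for the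
explicit collection on every RATIONAL matching pair `(γ_H, γ)` with `γ_H = (g, u)` **`G`-regular** (the binder of ★ `SatisfiesProductFormula`).  Print uses the
same product formula at the SINGULAR semisimple `γ₀ ∈ M` of [Rogawski1990, Prop. 8.2.1 (b)] — «Part (b) follows from (a) and the product formula
`ΠΔ_{G_v∕H_v}(γ_{ov}) = 1` for `γ₀ ∈ M`» (p. 117) — where `γ_H = (e₁•1₂, e₂)` is central in `H`, `(G,H)`-regular (`u = e₂` is not an eigenvalue of `g = e₁•1₂`)
but NOT `G`-regular (`ι(γ_H)` has the double eigenvalue `e₁`).  This file removes the `G`-regularity hypothesis: everything in p828307's proof consumed it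
ONLY through the two non-vanishings `χ_g(u) ≠ 0` and `P = χ_g(γ) ≠ 0`, and both hold as soon as
  `hχ : χ_g(u) = (charpoly g).eval u ≠ 0`                                                                                    — (G,H)-regularity —
(at the singular partner `χ_{e₁•1}(e₂) = (e₂ − e₁)² ≠ 0`).  So:
* part 1 (`…GHRegularParts`): `archKappaSignAt_eq_sign_re_embedding_columnFormValue'` (★ `…Parts` :219 without `hreg`∕`hanis`∕`hherm`),
  `evalC_eval_archCharpolyTwo_rationalArch_ne_zero`, `globalProjector_ne_zero_of_eval_ne_zero`, `exists_kappa_eq_hilbertSymbol_of_eval_ne_zero` (all the `κ`'s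
  of a rational pair with `χ_g(u) ≠ 0` are Hilbert symbols of ONE global `x ∈ (L⁺)ˣ`, `x ≠ 0` by anisotropy).
* here (§4): the three partial products (`τ`: Hecke reciprocity at the principal idèles `u`, `−χ_g(u)·det g⁻¹`; `D`: Artin–Whaples for `χ_g(u) ≠ 0`; `κ`: Hilbert
  reciprocity) and the assembly **`finprod_finExplicitDelta_mul_archCanonicalDelta_eq_one_of_eval_ne_zero`** (T1), and its spelling through ★
  `adelicTransferFactor … (finExplicitCollection …)` = the BODY of ★ `SatisfiesProductFormula` with `IsGRegular` replaced by `hχ` (T2,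
  `adelicTransferFactor_finExplicitCollection_mul_archCanonicalDelta_eq_one_of_eval_ne_zero`); ★ p828307 is (T2) ∘ ★ `eval_charpoly_gammaTwo_ne_zero_of_isGRegular`;
  and (T3) `eventually_finExplicitDelta_rationalComponent_eq_one_of_eval_ne_zero`: `Δ‴_v((γ_H)_v, γ_v) = 1` for almost all `v` at such a pair (the
  singular-pair companion of ★ `IsAlmostEverywhereTrivial`, which binds `IsGRegular`).
HONEST LABEL: HC_CM is proved only modulo the printed citations until rung 0 closes; this file is a count-neutral brick toward the (κ-sign) conjunct of the
letter S1′ `stub_tamagawaSingularMembers_exist` of `Cruxes/H413/Lines/F0_P3a_SingularEllipticTransferPaydown.lean` (the product formula is ONE input of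
print's proof of 8.2.1 (b); the local identities (κ-loc)∕(κ-arch) that define the constants remain print) — no stub closes.

## References
* [Rogawski1990] J. D. Rogawski, *Automorphic Representations of Unitary Groups in Three Variables*, Ann. of Math. Stud. 123 (1990), §8.2 Prop. 8.2.1 (b)
  proof p. 117 («the product formula `ΠΔ_{G_v∕H_v}(γ_{ov}) = 1` for `γ₀ ∈ M`»); §4.3 (4.3.3) p. 44; §4.9 p. 55; §14.6 p. 242; §3.5 Prop. 3.5.2 (c) p. 29.
* [LanglandsShelstad1987] R. P. Langlands, D. Shelstad, *On the definition of transfer factors*, Math. Ann. 278 (1987), §6.3–§6.4 (product formula).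
* [Omeara1963] O. T. O'Meara, *Introduction to Quadratic Forms* (1963), §71 Thm. 71:18 (Hilbert reciprocity).
-/

set_option autoImplicit false

noncomputable section

open NumberField NumberField.InfinitePlace NumberField.mixedEmbedding IsDedekindDomain Filter Matrix
open Literature.NumberTheory.GaloisRepresentations
open Literature.AlgebraicGeometry.ShimuraVarieties (hermForm)
open scoped Classical ComplexOrder MatrixGroups

namespace Literature.NumberTheory.Rogawski1990

open Literature.NumberTheory.Automorphic

variable (L : Type) [Field L] [NumberField L]

/-! ## §4 The three partial products under `χ_g(u) ≠ 0`, and the product formula -/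

section Assembly

variable [IsCMField L] (H' : Matrix (Fin 3) (Fin 3) L) (μ : HeckeCharacter L)
  (γH : (UnitaryGroup.cmDatum L 2 (Matrix.of fun i j : Fin 2 => if i.val + j.val + 1 = 2 then (1 : L) else 0)).Rational ×
      (UnitaryGroup.cmDatum L 1 (Matrix.of fun i j : Fin 1 => if i.val + j.val + 1 = 1 then (1 : L) else 0)).Rational)

/-- The `τ`-argument `−χ_g(u)·det g⁻¹ ≠ 0` under `χ_g(u) ≠ 0` (★ `det_inv_fst_ne_zero`). [cite: Rogawski1990, §4.9 p. 55] -/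
theorem tauArg_ne_zero_of_eval_ne_zero
    (hχ : ((γH.1.val.val : Matrix (Fin 2) (Fin 2) L).charpoly).eval ((γH.2.val.val : Matrix (Fin 1) (Fin 1) L) 0 0) ≠ 0) :
    -(((γH.1.val.val : Matrix (Fin 2) (Fin 2) L).charpoly).eval ((γH.2.val.val : Matrix (Fin 1) (Fin 1) L) 0 0)) *
        (((γH.1.val⁻¹).val : Matrix (Fin 2) (Fin 2) L).det) ≠ 0 :=
  mul_ne_zero (neg_ne_zero.2 hχ) (det_inv_fst_ne_zero L γH)

/-- **`τ`-PART: `(∏_v τ_v((γ_H)_v)) · τ_∞(γ_H ⊗ 1) = 1`** for a rational `γ_H` with `χ_g(u) ≠ 0` (★ `finTau_rationalComponent`, ★ `archTau_rationalArch`,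
★ `archHeckeValue_div_mul_finprod_finHeckeValue_div_eq_one`). [cite: Rogawski1990, §4.9 p. 55; §14.6 p. 242] -/
theorem finprod_finTau_mul_archTau_eq_one_of_eval_ne_zero
    (hχ : ((γH.1.val.val : Matrix (Fin 2) (Fin 2) L).charpoly).eval ((γH.2.val.val : Matrix (Fin 1) (Fin 1) L) 0 0) ≠ 0) :
    (∏ᶠ v : HeightOneSpectrum (𝓞 ↥(maximalRealSubfield L)), finTau L v (rationalComponent L γH v) μ) * archTau L (rationalArch L γH) μ = 1 := by
  have key := archHeckeValue_div_mul_finprod_finHeckeValue_div_eq_one L μ (Units.mk0 _ (gammaTwo_ne_zero L γH))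
    (Units.mk0 _ (tauArg_ne_zero_of_eval_ne_zero L γH hχ))
  simp only [Units.val_mk0] at key
  rw [finprod_congr fun v => finTau_rationalComponent L v γH μ, archTau_rationalArch, mul_comm]
  exact key

/-- **`D`-PART: `(∏_v D_{G∕H,v}((γ_H)_v)) · D_{G∕H,∞}(γ_H ⊗ 1) = 1`** for a rational `γ_H` with `χ_g(u) ≠ 0` (★ `finWeylRatio_rationalComponent`,
★ `archWeylRatio_rationalArch`, ★ `prod_norm_embedding_mul_finprod_sqrt_eq_one`). [cite: Rogawski1990, §4.9 p. 55; §14.6 p. 242] -/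
theorem finprod_finWeylRatio_mul_archWeylRatio_eq_one_of_eval_ne_zero
    (hχ : ((γH.1.val.val : Matrix (Fin 2) (Fin 2) L).charpoly).eval ((γH.2.val.val : Matrix (Fin 1) (Fin 1) L) 0 0) ≠ 0) :
    (∏ᶠ v : HeightOneSpectrum (𝓞 ↥(maximalRealSubfield L)), finWeylRatio L v (rationalComponent L γH v)) * archWeylRatio L (rationalArch L γH) = 1 := by
  rw [finprod_congr fun v => finWeylRatio_rationalComponent L v γH, archWeylRatio_rationalArch, mul_comm]
  exact prod_norm_embedding_mul_finprod_sqrt_eq_one L hχ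

variable (γ : (UnitaryGroup.cmDatum L 3 H').Rational)

/-- `θ ≠ 0`. [folklore] -/
private theorem cmQuadraticGenerator_ne_zero' : (cmQuadraticGenerator L : ↥(maximalRealSubfield L)) ≠ 0 := fun h =>
  not_isSquare_cmQuadraticGenerator L (by rw [h]; exact IsSquare.zero)

/-- **`κ`-PART: `(∏_v κ_v((γ_H)_v, γ_v)) · ∏_w κ‴_w(γ_H ⊗ 1, γ ⊗ 1) = 1`** on a rational matching pair with `χ_g(u) ≠ 0` (`c`-hermitian anisotropic
`H′`): all the `κ`'s are the local symbols `(x, θ)_v`, `(x, θ)_{w|L⁺}` of one `x ∈ (L⁺)ˣ` (`exists_kappa_eq_hilbertSymbol_of_eval_ne_zero`), and Hilbert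
reciprocity (★ `finprod_hilbertSymbol_mul_prod_infinitePlace_hilbertSymbol_eq_one`) closes. [cite: Rogawski1990, §14.6 p. 242] [cite: Omeara1963, §71 Thm. 71:18] -/
theorem finprod_finKappaAt_mul_prod_archKappaSignAt_eq_one_of_eval_ne_zero (hherm : (H'.map (cmConjRingHom L)).transpose = H')
    (hanis : ∀ x : Fin 3 → L, hermForm (cmConjRingHom L) H' x x = 0 → x = 0)
    (hχ : ((γH.1.val.val : Matrix (Fin 2) (Fin 2) L).charpoly).eval ((γH.2.val.val : Matrix (Fin 1) (Fin 1) L) 0 0) ≠ 0)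
    (hγ : IsNormPair L H' γH γ) :
    (∏ᶠ v : HeightOneSpectrum (𝓞 ↥(maximalRealSubfield L)),
        finKappaAt L v H' (rationalComponent L γH v) ((UnitaryGroup.cmDatum L 3 H').toLocal v ((UnitaryGroup.cmDatum L 3 H').toAdelic γ))) *
      ∏ w : {w : InfinitePlace L // IsComplex w}, archKappaSignAt L H' (rationalArch L γH) w (cmRationalToArch L 3 H' γ) = 1 := by
  obtain ⟨x, hx0, hfin, harch⟩ := exists_kappa_eq_hilbertSymbol_of_eval_ne_zero L H' γH γ hherm hanis hχ hγ
  have hx0' : (x : ↥(maximalRealSubfield L)) ≠ 0 := hx0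
  rw [finprod_congr hfin, Finset.prod_congr rfl fun w _ => harch w]
  have hcoe : ∀ v : HeightOneSpectrum (𝓞 ↥(maximalRealSubfield L)),
      QuadraticForms.hilbertSymbol (v.adicCompletion ↥(maximalRealSubfield L)) (x : v.adicCompletion ↥(maximalRealSubfield L))
          ((cmQuadraticGenerator L : ↥(maximalRealSubfield L)) : v.adicCompletion ↥(maximalRealSubfield L)) =
        QuadraticForms.hilbertSymbol (v.adicCompletion ↥(maximalRealSubfield L)) (algebraMap _ _ x)
          (algebraMap _ _ (cmQuadraticGenerator L : ↥(maximalRealSubfield L))) := fun v => by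
    rw [algebraMap_adicCompletion_apply, algebraMap_adicCompletion_apply]
  rw [finprod_congr hcoe,
    Fintype.prod_equiv ((Equiv.subtypeUnivEquiv fun w : InfinitePlace L => IsTotallyComplex.isComplex w).trans (IsCMField.equivInfinitePlace L))
      (fun w : {w : InfinitePlace L // IsComplex w} =>
        QuadraticForms.hilbertSymbol (IsCMField.equivInfinitePlace L w.1).Completion (algebraMap ↥(maximalRealSubfield L) _ x)
          (algebraMap ↥(maximalRealSubfield L) _ (cmQuadraticGenerator L : ↥(maximalRealSubfield L))))
      (fun w' : InfinitePlace ↥(maximalRealSubfield L) =>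
        QuadraticForms.hilbertSymbol w'.Completion (algebraMap ↥(maximalRealSubfield L) _ x)
          (algebraMap ↥(maximalRealSubfield L) _ (cmQuadraticGenerator L : ↥(maximalRealSubfield L))))
      fun w => rfl]
  exact finprod_hilbertSymbol_mul_prod_infinitePlace_hilbertSymbol_eq_one ↥(maximalRealSubfield L) hx0' (cmQuadraticGenerator_ne_zero' L)

/-- **(T1) THE PRODUCT FORMULA FOR ROGAWSKI'S EXPLICIT FACTORS AT A `(G,H)`-REGULAR RATIONAL MATCHING PAIR**: for a `c`-hermitian anisotropic `H′`, any
Hecke character `μ`, a rational pair `γ_H = (g, u) → γ` (★ `IsNormPair`) with `χ_g(u) ≠ 0` — `u` not an eigenvalue of `g`; `γ` may be SINGULAR in `G`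
(e.g. print's `γ₀ ∈ M` with `γ_H = (e₁•1₂, e₂)`, `χ_g(e₂) = (e₂ − e₁)²`) —
`(∏ᶠ_v Δ‴_v((γ_H)_v, γ_v)) · Δ‴_∞(γ_H ⊗ 1, γ ⊗ 1) = 1` (★ `finExplicitDelta`, ★ `archCanonicalDelta`; the three factors `τ`, `D_{G∕H}`, `κ` die separately by
the Hecke, Artin–Whaples and Hilbert reciprocity laws).  Print: «the product formula `ΠΔ_{G_v∕H_v}(γ_{ov}) = 1` for `γ₀ ∈ M`».
[cite: Rogawski1990, §8.2 Prop. 8.2.1 (b) proof p. 117; §4.3 (4.3.3) p. 44; §14.6 p. 242] [cite: LanglandsShelstad1987, §6.4] -/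
theorem finprod_finExplicitDelta_mul_archCanonicalDelta_eq_one_of_eval_ne_zero (hherm : (H'.map (cmConjRingHom L)).transpose = H')
    (hanis : ∀ x : Fin 3 → L, hermForm (cmConjRingHom L) H' x x = 0 → x = 0)
    (hχ : ((γH.1.val.val : Matrix (Fin 2) (Fin 2) L).charpoly).eval ((γH.2.val.val : Matrix (Fin 1) (Fin 1) L) 0 0) ≠ 0)
    (hγ : IsNormPair L H' γH γ) :
    (∏ᶠ v : HeightOneSpectrum (𝓞 ↥(maximalRealSubfield L)),
        finExplicitDelta L v H' (rationalComponent L γH v) μ ((UnitaryGroup.cmDatum L 3 H').toLocal v ((UnitaryGroup.cmDatum L 3 H').toAdelic γ))) *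
      archCanonicalDelta L H' (rationalArch L γH) μ (cmRationalToArch L 3 H' γ) = 1 := by
  have hp : ∀ v, IsLocalNormPair L H' v (rationalComponent L γH v)
      ((UnitaryGroup.cmDatum L 3 H').toLocal v ((UnitaryGroup.cmDatum L 3 H').toAdelic γ)) :=
    fun v => isLocalNormPair_rationalComponent_toLocal_toAdelic hγ v
  have hparch := isArchNormPair_rationalArch_cmRationalToArch hγ
  rw [finprod_congr fun v => finExplicitDelta_of_isLocalNormPair L v H' (rationalComponent L γH v) μ (hp v),
    archCanonicalDelta_of_isArchNormPair L H' (rationalArch L γH) μ hparch]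
  -- finiteness of the three supports
  have hτf : (Function.mulSupport fun v : HeightOneSpectrum (𝓞 ↥(maximalRealSubfield L)) => finTau L v (rationalComponent L γH v) μ).Finite := by
    have h1 := finite_mulSupport_finHeckeValue_algebraMap L μ (Units.mk0 _ (gammaTwo_ne_zero L γH))
    have h2 := finite_mulSupport_finHeckeValue_algebraMap L μ (Units.mk0 _ (tauArg_ne_zero_of_eval_ne_zero L γH hχ))
    refine (h1.union h2).subset fun v hv => ?_
    simp only [Function.mem_mulSupport, ne_eq] at hv
    by_contra hv'
    rw [Set.mem_union, not_or, Function.notMem_mulSupport, Function.notMem_mulSupport, Units.val_mk0, Units.val_mk0] at hv'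
    refine hv ?_
    rw [finTau_rationalComponent, hv'.1, hv'.2, inv_one, mul_one]
  have hDf : (Function.mulSupport fun v : HeightOneSpectrum (𝓞 ↥(maximalRealSubfield L)) =>
      ((finWeylRatio L v (rationalComponent L γH v) : ℝ) : ℂ)).Finite := by
    refine (eventually_cofinite.1 (eventually_prod_placesOver_norm_coe_eq_one (↥(maximalRealSubfield L)) (E := L) hχ)).subset fun v hv => ?_
    simp only [Function.mem_mulSupport, ne_eq] at hv
    by_contra hv'
    rw [Set.mem_setOf_eq, not_not] at hv'
    refine hv ?_
    rw [finWeylRatio_rationalComponent]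
    have h1 : (∏ w : UnitaryGroup.PlacesOver L v, ‖algebraMap L (w.1.adicCompletion L)
        (((γH.1.val.val : Matrix (Fin 2) (Fin 2) L).charpoly).eval ((γH.2.val.val : Matrix (Fin 1) (Fin 1) L) 0 0))‖) = 1 := by
      rw [← hv']
      exact Finset.prod_congr rfl fun w _ => by rw [algebraMap_adicCompletion_apply]
    rw [h1, Real.sqrt_one, Complex.ofReal_one]
  obtain ⟨x, hx0, hfin, -⟩ := exists_kappa_eq_hilbertSymbol_of_eval_ne_zero L H' γH γ hherm hanis hχ hγ
  have hκf : (Function.mulSupport fun v : HeightOneSpectrum (𝓞 ↥(maximalRealSubfield L)) =>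
      ((finKappaAt L v H' (rationalComponent L γH v) ((UnitaryGroup.cmDatum L 3 H').toLocal v ((UnitaryGroup.cmDatum L 3 H').toAdelic γ)) : ℤ) : ℂ)).Finite := by
    have hx0' : (x : ↥(maximalRealSubfield L)) ≠ 0 := hx0
    refine (eventually_cofinite.1 (eventually_hilbertSymbol_adicCompletion_eq_one ↥(maximalRealSubfield L) hx0'
      (cmQuadraticGenerator_ne_zero' L))).subset fun v hv => ?_
    simp only [Function.mem_mulSupport, ne_eq] at hv
    by_contra hv'
    rw [Set.mem_setOf_eq, not_not] at hv'
    refine hv ?_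
    rw [hfin v, ← algebraMap_adicCompletion_apply, ← algebraMap_adicCompletion_apply, hv', Int.cast_one]
  -- split the finite product and regroup
  have hτ := finprod_finTau_mul_archTau_eq_one_of_eval_ne_zero L μ γH hχ
  have hD := finprod_finWeylRatio_mul_archWeylRatio_eq_one_of_eval_ne_zero L γH hχ
  have hκ := finprod_finKappaAt_mul_prod_archKappaSignAt_eq_one_of_eval_ne_zero L H' γH γ hherm hanis hχ hγ
  have hDℂ : (∏ᶠ v : HeightOneSpectrum (𝓞 ↥(maximalRealSubfield L)), ((finWeylRatio L v (rationalComponent L γH v) : ℝ) : ℂ)) *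
      (archWeylRatio L (rationalArch L γH) : ℂ) = 1 := by
    have hDf' : (Function.mulSupport fun v : HeightOneSpectrum (𝓞 ↥(maximalRealSubfield L)) =>
        finWeylRatio L v (rationalComponent L γH v)).Finite :=
      hDf.subset fun v hv hv1 => hv (by
        change ((finWeylRatio L v (rationalComponent L γH v) : ℝ) : ℂ) = 1 at hv1
        change finWeylRatio L v (rationalComponent L γH v) = 1
        exact_mod_cast hv1)
    have hmap := map_finprod Complex.ofRealHom hDf'
    simp only [Complex.ofRealHom_eq_coe] at hmap
    rw [← hmap, ← Complex.ofReal_mul, hD, Complex.ofReal_one]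
  have hκℂ : (∏ᶠ v : HeightOneSpectrum (𝓞 ↥(maximalRealSubfield L)),
        ((finKappaAt L v H' (rationalComponent L γH v) ((UnitaryGroup.cmDatum L 3 H').toLocal v ((UnitaryGroup.cmDatum L 3 H').toAdelic γ)) : ℤ) : ℂ)) *
      ((∏ w : {w : InfinitePlace L // IsComplex w}, archKappaSignAt L H' (rationalArch L γH) w (cmRationalToArch L 3 H' γ) : ℤ) : ℂ) = 1 := by
    have hκf' : (Function.mulSupport fun v : HeightOneSpectrum (𝓞 ↥(maximalRealSubfield L)) =>
        finKappaAt L v H' (rationalComponent L γH v) ((UnitaryGroup.cmDatum L 3 H').toLocal v ((UnitaryGroup.cmDatum L 3 H').toAdelic γ))).Finite :=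
      hκf.subset fun v hv hv1 => hv (by
        change ((finKappaAt L v H' (rationalComponent L γH v)
          ((UnitaryGroup.cmDatum L 3 H').toLocal v ((UnitaryGroup.cmDatum L 3 H').toAdelic γ)) : ℤ) : ℂ) = 1 at hv1
        change finKappaAt L v H' (rationalComponent L γH v)
          ((UnitaryGroup.cmDatum L 3 H').toLocal v ((UnitaryGroup.cmDatum L 3 H').toAdelic γ)) = 1
        exact_mod_cast hv1)
    have hmap := map_finprod (Int.castRingHom ℂ) hκf'
    simp only [Int.coe_castRingHom] at hmap
    rw [← hmap, ← Int.cast_mul, hκ, Int.cast_one]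
  rw [finprod_mul_distrib ((hτf.union hDf).subset (Function.mulSupport_mul _ _)) hκf, finprod_mul_distrib hτf hDf]
  calc (∏ᶠ v : HeightOneSpectrum (𝓞 ↥(maximalRealSubfield L)), finTau L v (rationalComponent L γH v) μ) *
          (∏ᶠ v : HeightOneSpectrum (𝓞 ↥(maximalRealSubfield L)), ((finWeylRatio L v (rationalComponent L γH v) : ℝ) : ℂ)) *
          (∏ᶠ v : HeightOneSpectrum (𝓞 ↥(maximalRealSubfield L)),
            ((finKappaAt L v H' (rationalComponent L γH v) ((UnitaryGroup.cmDatum L 3 H').toLocal v ((UnitaryGroup.cmDatum L 3 H').toAdelic γ)) : ℤ) : ℂ)) *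
        (archTau L (rationalArch L γH) μ * (archWeylRatio L (rationalArch L γH) : ℂ) *
          ((∏ w : {w : InfinitePlace L // IsComplex w}, archKappaSignAt L H' (rationalArch L γH) w (cmRationalToArch L 3 H' γ) : ℤ) : ℂ))
      = ((∏ᶠ v : HeightOneSpectrum (𝓞 ↥(maximalRealSubfield L)), finTau L v (rationalComponent L γH v) μ) * archTau L (rationalArch L γH) μ) *
        ((∏ᶠ v : HeightOneSpectrum (𝓞 ↥(maximalRealSubfield L)), ((finWeylRatio L v (rationalComponent L γH v) : ℝ) : ℂ)) *
          (archWeylRatio L (rationalArch L γH) : ℂ)) *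
        ((∏ᶠ v : HeightOneSpectrum (𝓞 ↥(maximalRealSubfield L)),
            ((finKappaAt L v H' (rationalComponent L γH v) ((UnitaryGroup.cmDatum L 3 H').toLocal v ((UnitaryGroup.cmDatum L 3 H').toAdelic γ)) : ℤ) : ℂ)) *
          ((∏ w : {w : InfinitePlace L // IsComplex w}, archKappaSignAt L H' (rationalArch L γH) w (cmRationalToArch L 3 H' γ) : ℤ) : ℂ)) := by
        ring
    _ = 1 := by rw [hτ, hDℂ, hκℂ, one_mul, one_mul]

/-- **(T2) The same, spelled through ★ `adelicTransferFactor … (finExplicitCollection …)`** — the BODY of ★ `SatisfiesProductFormula L H′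
(finExplicitCollection L H′ μ hl hr) (archCanonicalDelta L H′ · μ ·)` with its `IsGRegular` binder replaced by `χ_g(u) ≠ 0` (the finite adelic factor of the
explicit collection at a rational pair is the `∏ᶠ` of the explicit local factors at the rational components, definitionally, as in ★ p828307).
[cite: Rogawski1990, §8.2 Prop. 8.2.1 (b) proof p. 117; §4.3 (4.3.3) p. 44] [cite: LanglandsShelstad1987, §6.4] -/
theorem adelicTransferFactor_finExplicitCollection_mul_archCanonicalDelta_eq_one_of_eval_ne_zero
    (hherm : (H'.map (cmConjRingHom L)).transpose = H')
    (hanis : ∀ x : Fin 3 → L, hermForm (cmConjRingHom L) H' x x = 0 → x = 0)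
    (hl : ∀ (v : HeightOneSpectrum (𝓞 ↥(maximalRealSubfield L)))
      (a : (UnitaryGroup.cmDatum L 2 (Matrix.of fun i j : Fin 2 => if i.val + j.val + 1 = 2 then (1 : L) else 0)).Local v ×
      (UnitaryGroup.cmDatum L 1 (Matrix.of fun i j : Fin 1 => if i.val + j.val + 1 = 1 then (1 : L) else 0)).Local v)
      (b : (UnitaryGroup.cmDatum L 3 H').Local v)
      (x : (UnitaryGroup.cmDatum L 2 (Matrix.of fun i j : Fin 2 => if i.val + j.val + 1 = 2 then (1 : L) else 0)).Local v ×
      (UnitaryGroup.cmDatum L 1 (Matrix.of fun i j : Fin 1 => if i.val + j.val + 1 = 1 then (1 : L) else 0)).Local v),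
      finExplicitDelta L v H' (x * a * x⁻¹) μ b = finExplicitDelta L v H' a μ b)
    (hr : ∀ (v : HeightOneSpectrum (𝓞 ↥(maximalRealSubfield L)))
      (a : (UnitaryGroup.cmDatum L 2 (Matrix.of fun i j : Fin 2 => if i.val + j.val + 1 = 2 then (1 : L) else 0)).Local v ×
      (UnitaryGroup.cmDatum L 1 (Matrix.of fun i j : Fin 1 => if i.val + j.val + 1 = 1 then (1 : L) else 0)).Local v)
      (b y : (UnitaryGroup.cmDatum L 3 H').Local v),
      finExplicitDelta L v H' a μ (y * b * y⁻¹) = finExplicitDelta L v H' a μ b)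
    (hχ : ((γH.1.val.val : Matrix (Fin 2) (Fin 2) L).charpoly).eval ((γH.2.val.val : Matrix (Fin 1) (Fin 1) L) 0 0) ≠ 0)
    (hγ : IsNormPair L H' γH γ) :
    adelicTransferFactor L H' (finExplicitCollection L H' μ hl hr)
          ((UnitaryGroup.cmDatum L 2 (Matrix.of fun i j : Fin 2 => if i.val + j.val + 1 = 2 then (1 : L) else 0)).toAdelic γH.1,
            (UnitaryGroup.cmDatum L 1 (Matrix.of fun i j : Fin 1 => if i.val + j.val + 1 = 1 then (1 : L) else 0)).toAdelic γH.2)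
          ((UnitaryGroup.cmDatum L 3 H').toAdelic γ) *
        archCanonicalDelta L H'
          (cmRationalToArch L 2 (Matrix.of fun i j : Fin 2 => if i.val + j.val + 1 = 2 then (1 : L) else 0) γH.1,
            cmRationalToArch L 1 (Matrix.of fun i j : Fin 1 => if i.val + j.val + 1 = 1 then (1 : L) else 0) γH.2) μ
          (cmRationalToArch L 3 H' γ) = 1 := by
  change (∏ᶠ v : HeightOneSpectrum (𝓞 ↥(maximalRealSubfield L)),
      finExplicitDelta L v H' (rationalComponent L γH v) μ ((UnitaryGroup.cmDatum L 3 H').toLocal v ((UnitaryGroup.cmDatum L 3 H').toAdelic γ))) *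
    archCanonicalDelta L H' (rationalArch L γH) μ (cmRationalToArch L 3 H' γ) = 1
  exact finprod_finExplicitDelta_mul_archCanonicalDelta_eq_one_of_eval_ne_zero L H' μ γH γ hherm hanis hχ hγ

/-- **(T3) A.E. TRIVIALITY AT A `(G,H)`-REGULAR RATIONAL MATCHING PAIR**: under `χ_g(u) ≠ 0`, `Δ‴_v((γ_H)_v, γ_v) = 1` for almost all `v` — `τ_v = 1`
and `D_v = 1` a.e. (semi-local components of `μ` at the global units `u`, `−χ_g(u)·det g⁻¹`, and `∏_{w∣v}‖χ_g(u)‖_w = 1` a.e., as in ★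
`eventually_finTau_rationalComponent_eq_one` ∕ ★ `eventually_finWeylRatio_rationalComponent_eq_one` but under `hχ`), `κ_v = (x, θ)_v = 1` a.e. by part 1
and ★ `eventually_hilbertSymbol_adicCompletion_eq_one`; the singular-pair companion of ★ `IsAlmostEverywhereTrivial` (which binds `IsGRegular`).  Print:
«`Δ_{G_v∕H_v}(γ_H, γ̄_v) = 1` for almost all `v`». [cite: Rogawski1990, §4.3 p. 44; §8.2 p. 117] [cite: LanglandsShelstad1987, §6.4] -/
theorem eventually_finExplicitDelta_rationalComponent_eq_one_of_eval_ne_zero (hherm : (H'.map (cmConjRingHom L)).transpose = H')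
    (hanis : ∀ x : Fin 3 → L, hermForm (cmConjRingHom L) H' x x = 0 → x = 0)
    (hχ : ((γH.1.val.val : Matrix (Fin 2) (Fin 2) L).charpoly).eval ((γH.2.val.val : Matrix (Fin 1) (Fin 1) L) 0 0) ≠ 0)
    (hγ : IsNormPair L H' γH γ) :
    ∀ᶠ v : HeightOneSpectrum (𝓞 ↥(maximalRealSubfield L)) in cofinite,
      finExplicitDelta L v H' (rationalComponent L γH v) μ ((UnitaryGroup.cmDatum L 3 H').toLocal v ((UnitaryGroup.cmDatum L 3 H').toAdelic γ)) = 1 := by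
  set u : L := (γH.2.val.val : Matrix (Fin 1) (Fin 1) L) 0 0 with hu
  set t : L := -(((γH.1.val.val : Matrix (Fin 2) (Fin 2) L).charpoly).eval u) * (((γH.1.val⁻¹).val : Matrix (Fin 2) (Fin 2) L)).det with ht
  have hu0 : u ≠ 0 := gammaTwo_ne_zero L γH
  have ht0 : t ≠ 0 := tauArg_ne_zero_of_eval_ne_zero L γH hχ
  obtain ⟨x, hx0, hfin, -⟩ := exists_kappa_eq_hilbertSymbol_of_eval_ne_zero L H' γH γ hherm hanis hχ hγ
  have hx0' : (x : ↥(maximalRealSubfield L)) ≠ 0 := hx0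
  filter_upwards [eventually_semilocalComponent_map_algebraMap_eq_one (↥(maximalRealSubfield L)) μ (Units.mk0 u hu0),
    eventually_semilocalComponent_map_algebraMap_eq_one (↥(maximalRealSubfield L)) μ (Units.mk0 t ht0),
    eventually_prod_placesOver_norm_coe_eq_one (↥(maximalRealSubfield L)) (E := L) hχ,
    eventually_hilbertSymbol_adicCompletion_eq_one ↥(maximalRealSubfield L) hx0' (cmQuadraticGenerator_ne_zero' L)] with v hv1 hv2 hv3 hv4
  have hm : IsLocalNormPair L H' v (rationalComponent L γH v) ((UnitaryGroup.cmDatum L 3 H').toLocal v ((UnitaryGroup.cmDatum L 3 H').toAdelic γ)) :=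
    isLocalNormPair_rationalComponent_toLocal_toAdelic hγ v
  -- `τ_v = 1`
  have hτ : finTau L v (rationalComponent L γH v) μ = 1 := by
    rw [finTau_rationalComponent]
    have h1 := finHeckeValue_algebraMap_units L μ v (Units.mk0 u hu0)
    have h2 := finHeckeValue_algebraMap_units L μ v (Units.mk0 t ht0)
    rw [Units.val_mk0] at h1 h2
    rw [← hu, ← ht, h1, h2, hv1, hv2, Units.val_one, inv_one, mul_one]
  -- `D_v = 1`
  have hD : finWeylRatio L v (rationalComponent L γH v) = 1 := by
    rw [finWeylRatio_rationalComponent]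
    have hv' : (∏ w : UnitaryGroup.PlacesOver L v,
        ‖algebraMap L (w.1.adicCompletion L) (((γH.1.val.val : Matrix (Fin 2) (Fin 2) L).charpoly).eval
          ((γH.2.val.val : Matrix (Fin 1) (Fin 1) L) 0 0))‖) = 1 := hv3
    rw [hv', Real.sqrt_one]
  -- `κ_v = 1`
  have hκ : finKappaAt L v H' (rationalComponent L γH v) ((UnitaryGroup.cmDatum L 3 H').toLocal v ((UnitaryGroup.cmDatum L 3 H').toAdelic γ)) = 1 := by
    rw [hfin v, ← algebraMap_adicCompletion_apply, ← algebraMap_adicCompletion_apply]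
    exact hv4
  rw [finExplicitDelta_of_isLocalNormPair L v H' _ μ hm, hτ, hD, hκ]
  simp

end Assembly


end Literature.NumberTheory.Rogawski1990
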